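import Summits.QuantumFields.YangMills.Theorems.PoincareLipschitzMassRowsOfLowCharts
import HarnessLib

/-!
# Crux stmt-QuantumFields-19936 `UnitScaleTilt.HistoryTailL`, K2 at depth (route crux `PoincareLipschitz.BlockLipschitzL`, stmt-QuantumFields-23533),
# F6 of the K2 supplier plan of record — file F6-ROW-DEEPLOWCHART: THE SOCKET SHRUNK TO THE DEEP THIRD
# (an `ℓ²`-near pair at depth `j + 1 ≤ K∕3` is small data once `γ` is small, so it has NO low level: charts are owed only for `K < 3(j+1)`)

Cell `ym3-torus` (YM ladder rung R3 = continuum SU(2) Yang–Mills on the three-torus — a RUNG, NOT the Clay problem: not d = 4, not infinite volume,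
not a mass gap); width seat `ym-ust-19936-w2` g11, F6 pen (LEAD `ym-ust-19936-w1` g7, card v1.31 «F6-ROW-CHART∕SOCKET GO»).  Helper
`--supports stmt-QuantumFields-19936`; THEOREMS ONLY (0 `def`, 0 `sorry`).  Nothing here proves the charts, h⋆ at depth, `stub_iteratedLipschitz`,
`BlockLipschitzL`, `HistoryTailL` or a summit statement.

WHY.  ✓`PoincareLipschitzMassRowsOfLowCharts.charts_of_lowCharts` asks per-bond charts only at LOW levels `((10⁸L⁷)⁻¹)²(4∕9)^i < 4L^{−i}·Bx`.  For an
`ℓ²`-NEAR pair (`√Bx ≤ T·√(L^{j+1})·θBal(K−j)`, hStab⋆'s binder) at a SHALLOW depth `3(j+1) ≤ K` the right side is uniformly small: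
`θBal(K−j) ≤ C(b₀,p₀)·(γL^{−(K−j)})^{1∕4}` (lit ✓`T3Thresholds.θBal_le_const_mul_sqrt_coupling`) and `L^{2(j+1)}·L^{−(K−j)} ≤ 1`, so
`4Bx ≤ 4T²C²·√γ ≤ τ²` for `γ ≤ γ₃(L, b₀, p₀, T)` — NO level is low, the chart clause is vacuous, and `m := 0`, `σ := 0` serve.  Hence the supplier owes charts
only in the DEEP THIRD `K < 3(j+1)` (and there only at the low levels): this file types `hDeepLow ⇒ hLow` (`γ₂ := min γ₂ γ₃`), hence ⇒ charts ⇒ rows ⇒ h⋆ ⇒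
`stub_iteratedLipschitz`.  (Card v1.30∕v1.31's «EMPTY at shallow depths» made a lemma: the `p`-function costs half the decay, whence `K∕3` rather than `K∕2`
with this crude bound; any `(½ − δ)K` is reachable with ✓`gp_le_const_mul_sqrt`'s `c`-variant, not needed here.)

WHAT IS PROVED (ns `…Theorems.PoincareLipschitzMassRowsOfDeepLowCharts`).
* §1 `pow_mul_inv_pow_le_one` (`L^{2(j+1)}·(L⁻¹)^{K−j} ≤ 1` for `3(j+1) ≤ K`), ★`near_shallow_four_Bx_le` (the numerics: `∃ γ₃, … 3(j+1) ≤ K → √Bx ≤ T√(L^{j+1})θBal(K−j) → 4Bx ≤ τ²`),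
  `not_low_of_four_Bx_le` (`4Bx ≤ τ² ⇒ ¬ (τ²(4∕9)^i < 4L^{−i}Bx)` for `L ≥ 3`).
* §2 ★★★ `lowCharts_of_deepLowCharts (hDeep) : <✓LOWCHART's hLow VERBATIM>`.
* §3 ★★★ `stub_iteratedLipschitz_of_deepLowCharts`, `avgStability_star_of_deepLowCharts`.
HONEST SCOPE.  Real-number bookkeeping on `θBal`; the deep low-level charts are displayed, NOT proved.  YM₃ on T³ is rung R3, not the Clay problem.

References: T. Bałaban, CMP 102 (1985) 255–275 [Balaban1985UV3] ((3), (5), (7) pp.256–257); CMP 98 (1985) 17–51 [Balaban1985Averaging] (Props 1–3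
(122)–(126) p.36); CMP 109 (1987) 249–301 [Balaban1987RG1] ((0.4) p.253).
-/

noncomputable section

open scoped BigOperators Matrix.Norms.L2Operator
open NormedSpace

namespace Summit.QuantumFields.YangMills.Theorems.PoincareLipschitzMassRowsOfDeepLowCharts

open Literature.MathematicalPhysics.QuantumFieldTheory.Balaban1983to89
open Literature.MathematicalPhysics.QuantumFieldTheory.Balaban1983to89.T3ContinuumYM3Torus
open Literature.MathematicalPhysics.QuantumFieldTheory.Balaban1983to89.T3UnitScaleTilt (θBal)
open Literature.MathematicalPhysics.QuantumFieldTheory.Balaban1983to89.T3Thresholds (θBal_le_const_mul_sqrt_coupling)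
open Finset T4Continuum BlockAveraging AveragingRT ExpMeanLog BlockAveragingEMLLinearised BlockAveragingEMLLinearisedBackground
open Summit.QuantumFields.YangMills.Theorems.PoincareLipschitzMassRowsOfLowCharts (charts_of_lowCharts avgStability_star_of_lowCharts
  stub_iteratedLipschitz_of_lowCharts)

/-! ## §1 Numerics on the thresholds -/

/-- `L^{2(j+1)}·(L⁻¹)^{K−j} ≤ 1` for `L ≥ 1` and `3(j+1) ≤ K`. [folklore] -/
theorem pow_mul_inv_pow_le_one {L : ℝ} (hL : 1 ≤ L) {K j : ℕ} (hjK : 3 * (j + 1) ≤ K) :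
    L ^ (2 * (j + 1)) * (L⁻¹) ^ (K - j) ≤ 1 := by
  have hL0 : 0 < L := by linarith
  have hinv1 : L⁻¹ ≤ 1 := inv_le_one_of_one_le₀ hL
  have hinv0 : 0 ≤ L⁻¹ := inv_nonneg.2 hL0.le
  have h1 : (L⁻¹) ^ (K - j) ≤ (L⁻¹) ^ (2 * (j + 1)) := pow_le_pow_of_le_one hinv0 hinv1 (by omega)
  calc L ^ (2 * (j + 1)) * (L⁻¹) ^ (K - j) ≤ L ^ (2 * (j + 1)) * (L⁻¹) ^ (2 * (j + 1)) :=
        mul_le_mul_of_nonneg_left h1 (by positivity)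
    _ = 1 := by rw [← mul_pow, mul_inv_cancel₀ hL0.ne', one_pow]

/-- ★ **NEAR + SHALLOW ⇒ SMALL DATA**: for `L ≥ 1`, `b₀, p₀ > 0`, `T ≥ 0`, `τ > 0` there is `γ₃ ∈ (0, 1]` such that for `0 < γ ≤ γ₃`, every `K, j` with
`3(j+1) ≤ K` and every `Bx ≥ 0` with `√Bx ≤ T·√(L^{j+1})·θBal(K−j)`: `4·Bx ≤ τ²` (`θBal(K−j) ≤ C·(γL^{−(K−j)})^{1∕4}`, `L^{2(j+1)}L^{−(K−j)} ≤ 1`).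
[cite: Balaban1985UV3, (7) p.257] -/
theorem near_shallow_four_Bx_le {L : ℕ} (hL : 1 ≤ L) {b₀ p₀ : ℝ} (hb : 0 < b₀) (hp : 0 < p₀) {T τ : ℝ} (hT : 0 ≤ T) (hτ : 0 < τ) :
    ∃ γ₃ : ℝ, 0 < γ₃ ∧ γ₃ ≤ 1 ∧ ∀ γ : ℝ, 0 < γ → γ ≤ γ₃ → ∀ K j : ℕ, 3 * (j + 1) ≤ K → ∀ Bx : ℝ, 0 ≤ Bx →
      Real.sqrt Bx ≤ T * Real.sqrt ((L : ℝ) ^ (j + 1)) * θBal L γ b₀ p₀ (K - j) → 4 * Bx ≤ τ ^ 2 := by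
  -- the constant of ✓`θBal_le_const_mul_sqrt_coupling`
  set C : ℝ := b₀ * ((2 * p₀) ^ p₀ * Real.exp (1 / 2 - p₀)) with hC
  have hC0 : 0 ≤ C := by positivity
  set A : ℝ := 4 * T ^ 2 * C ^ 2 + 1 with hA
  have hA0 : 0 < A := by positivity
  refine ⟨min 1 ((τ ^ 2 / A) ^ 2), lt_min one_pos (by positivity), min_le_left _ _, ?_⟩
  intro γ hγ hγle K j hjK Bx hBx hnear
  have hγ1 : γ ≤ 1 := hγle.trans (min_le_left _ _)
  have hγA : γ ≤ (τ ^ 2 / A) ^ 2 := hγle.trans (min_le_right _ _)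
  have hLr : (1 : ℝ) ≤ (L : ℝ) := by exact_mod_cast hL
  have hL0 : (0 : ℝ) < (L : ℝ) := by linarith
  -- `θBal(K−j) ≤ C·√(√(γ·(L⁻¹)^{K−j}))`
  have hθ := θBal_le_const_mul_sqrt_coupling (L := L) (γ := γ) (b₀ := b₀) (p₀ := p₀) hL hγ hγ1 hb.le hp (K - j)
  -- `√(L^{j+1})·√(√(γ q)) ≤ √(√γ)`
  have hq : Real.sqrt ((L : ℝ) ^ (j + 1)) * Real.sqrt (Real.sqrt (γ * ((L : ℝ)⁻¹) ^ (K - j))) ≤ Real.sqrt (Real.sqrt γ) := by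
    have e1 : Real.sqrt (Real.sqrt ((((L : ℝ) ^ (j + 1))) ^ 2)) = Real.sqrt ((L : ℝ) ^ (j + 1)) := by
      rw [Real.sqrt_sq (by positivity)]
    rw [← e1, ← Real.sqrt_mul (Real.sqrt_nonneg _), ← Real.sqrt_mul (by positivity)]
    refine Real.sqrt_le_sqrt (Real.sqrt_le_sqrt ?_)
    calc ((L : ℝ) ^ (j + 1)) ^ 2 * (γ * ((L : ℝ)⁻¹) ^ (K - j)) = γ * ((L : ℝ) ^ (2 * (j + 1)) * ((L : ℝ)⁻¹) ^ (K - j)) := by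
          rw [← pow_mul, mul_comm (j + 1) 2]; ring
      _ ≤ γ * 1 := mul_le_mul_of_nonneg_left (pow_mul_inv_pow_le_one hLr hjK) hγ.le
      _ = γ := mul_one γ
  -- so `√Bx ≤ T·C·√(√γ)`
  have h1 : Real.sqrt Bx ≤ T * C * Real.sqrt (Real.sqrt γ) := by
    calc Real.sqrt Bx ≤ T * Real.sqrt ((L : ℝ) ^ (j + 1)) * θBal L γ b₀ p₀ (K - j) := hnear
      _ ≤ T * Real.sqrt ((L : ℝ) ^ (j + 1)) * (C * Real.sqrt (Real.sqrt (γ * ((L : ℝ)⁻¹) ^ (K - j)))) :=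
          mul_le_mul_of_nonneg_left (by simpa only [hC] using hθ) (by positivity)
      _ = T * C * (Real.sqrt ((L : ℝ) ^ (j + 1)) * Real.sqrt (Real.sqrt (γ * ((L : ℝ)⁻¹) ^ (K - j)))) := by ring
      _ ≤ T * C * Real.sqrt (Real.sqrt γ) := mul_le_mul_of_nonneg_left hq (by positivity)
  -- square twice: `4Bx ≤ 4T²C²·√γ ≤ τ²`
  have h2 : Bx ≤ (T * C) ^ 2 * Real.sqrt γ := by
    have := pow_le_pow_left₀ (Real.sqrt_nonneg Bx) h1 2
    rw [Real.sq_sqrt hBx, mul_pow, Real.sq_sqrt (Real.sqrt_nonneg γ)] at this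
    exact this
  have h3 : Real.sqrt γ ≤ τ ^ 2 / A := by
    rw [← Real.sqrt_sq (by positivity : 0 ≤ τ ^ 2 / A)]
    exact Real.sqrt_le_sqrt hγA
  have h4 : 4 * ((T * C) ^ 2 * Real.sqrt γ) ≤ 4 * ((T * C) ^ 2 * (τ ^ 2 / A)) := by
    have : 0 ≤ (T * C) ^ 2 := sq_nonneg _
    nlinarith
  have h5 : 4 * ((T * C) ^ 2 * (τ ^ 2 / A)) ≤ τ ^ 2 := by
    rw [show 4 * ((T * C) ^ 2 * (τ ^ 2 / A)) = (4 * T ^ 2 * C ^ 2 / A) * τ ^ 2 by ring]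
    have hfrac : 4 * T ^ 2 * C ^ 2 / A ≤ 1 := by
      rw [div_le_one hA0, hA]; linarith
    nlinarith [sq_nonneg τ]
  linarith

/-- `4·Bx ≤ τ²` ⇒ no level is low: `¬ (τ²·(4∕9)^i < 4·(L^i)⁻¹·Bx)` for `L ≥ 3`, `Bx ≥ 0`. [folklore] -/
theorem not_low_of_four_Bx_le {L : ℝ} (hL : 3 ≤ L) {τ Bx : ℝ} (hBx : 0 ≤ Bx) (h : 4 * Bx ≤ τ ^ 2) (i : ℕ) :
    ¬ (τ ^ 2 * (4 / 9) ^ i < 4 * (L ^ i)⁻¹ * Bx) := by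
  rw [not_lt]
  have hL0 : 0 < L := by linarith
  have h1 : (L ^ i)⁻¹ ≤ ((4 : ℝ) / 9) ^ i := by
    rw [← inv_pow]
    exact pow_le_pow_left₀ (inv_nonneg.2 hL0.le) (by rw [inv_le_comm₀ hL0 (by norm_num)]; linarith) i
  have h49 : (0 : ℝ) ≤ (4 / 9) ^ i := by positivity
  calc 4 * (L ^ i)⁻¹ * Bx ≤ 4 * (4 / 9) ^ i * Bx := by
        have : 0 ≤ 4 * Bx := by linarith
        nlinarith [mul_le_mul_of_nonneg_left h1 this]
    _ = (4 * Bx) * (4 / 9) ^ i := by ring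
    _ ≤ τ ^ 2 * (4 / 9) ^ i := mul_le_mul_of_nonneg_right h h49

/-! ## §2 Low-level charts from deep low-level charts -/

/-- ★★★ **LOW-LEVEL CHARTS FROM DEEP LOW-LEVEL CHARTS.**  If ✓LOWCHART's hypothesis holds in the weaker form where the whole conclusion (`∃ m ∃ σ …`) is only
asked in the DEEP THIRD `K < 3(j+1)`, then it holds as stated: at shallow depths an `ℓ²`-near pair is small data for `γ ≤ γ₃` (`near_shallow_four_Bx_le`),
so `m := 0`, `σ := 0` serve and the chart clause is vacuous (`not_low_of_four_Bx_le`); `γ₂ := min γ₂ γ₃`. [cite: Balaban1985UV3, (7) p.257] -/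
theorem lowCharts_of_deepLowCharts
    (hDeep : open Literature.MathematicalPhysics.QuantumFieldTheory.Balaban1983to89 Literature.MathematicalPhysics.QuantumFieldTheory.Balaban1983to89.T3ContinuumYM3Torus in ∀ (L : ℕ), ∃ T : ℝ, 0 < T ∧ ∀ (b₀ p₀ : ℝ), 0 < b₀ → 2 < p₀ → ∃ γ₂ : ℝ, 0 < γ₂ ∧ ∀ (F : T3Family) (γ : ℝ), F.L = L → 0 < γ → γ ≤ γ₂ → ∀ (K j : ℕ), 1 ≤ j → j + 3 ≤ K → K < 3 * (j + 1) → ∀ (a : Plaq (F.P K) (j + 1)) (U U' : GaugeField (F.P K) 0 (Matrix.specialUnitaryGroup (Fin 2) ℂ)), (∀ (i : ℕ) (q : Plaq (F.P K) i), i < j + 1 → Site.tdist (fun k => ((((q.src k).val * F.L ^ i : ℕ)) : ZMod ((F.P K).sitesPerDir 0))) (fun k => ((((a.src k).val * F.L ^ (j + 1) : ℕ)) : ZMod ((F.P K).sitesPerDir 0))) + 64 * F.L ^ i ≤ 64 * F.L ^ (j + 1) → GaugeGroup.dist1 (GaugeField.plaqHol (Averaging.iter (fun i' => BlockAveraging.blockAvg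 (P := F.P K) (j := i') T3UnitLawDensityEML.ℰp) i U) q) < T3UnitScaleTilt.θBal F.L γ b₀ p₀ (K - i)) → (∀ (i : ℕ) (q : Plaq (F.P K) i), i < j + 1 → Site.tdist (fun k => ((((q.src k).val * F.L ^ i : ℕ)) : ZMod ((F.P K).sitesPerDir 0))) (fun k => ((((a.src k).val * F.L ^ (j + 1) : ℕ)) : ZMod ((F.P K).sitesPerDir 0))) + 64 * F.L ^ i ≤ 64 * F.L ^ (j + 1) → GaugeGroup.dist1 (GaugeField.plaqHol (Averaging.iter (fun i' => BlockAveraging.blockAvg (P := F.P K) (j := i') T3UnitLawDensityEML.ℰp) i U') q) < T3UnitScaleTilt.θBal F.L γ b₀ p₀ (K - i)) → (∀ k : GaugeTransf (F.P K) 0 (Matrix.specialUnitaryGroup (Fin 2) ℂ), (∑ b : PBond (F.P K) 0, if (∀ k, (b.src k - ((((a.src k).val * F.L ^ (j + 1) : ℕ)) : ZMod ((F.P K).sitesPerDir 0)) + ((8 * F.L ^ (j + 1) : ℕ) : ZMod ((F.P K).sitesPerDir 0))).val < 17 * F.L ^ (j + 1)) ∧ (∀ k, (b.tgt k - ((((a.src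 k).val * F.L ^ (j + 1) : ℕ)) : ZMod ((F.P K).sitesPerDir 0)) + ((8 * F.L ^ (j + 1) : ℕ) : ZMod ((F.P K).sitesPerDir 0))).val < 17 * F.L ^ (j + 1)) then GaugeGroup.dist1 (U b * (U' b)⁻¹) ^ 2 else 0) ≤ (∑ b : PBond (F.P K) 0, if (∀ k, (b.src k - ((((a.src k).val * F.L ^ (j + 1) : ℕ)) : ZMod ((F.P K).sitesPerDir 0)) + ((8 * F.L ^ (j + 1) : ℕ) : ZMod ((F.P K).sitesPerDir 0))).val < 17 * F.L ^ (j + 1)) ∧ (∀ k, (b.tgt k - ((((a.src k).val * F.L ^ (j + 1) : ℕ)) : ZMod ((F.P K).sitesPerDir 0)) + ((8 * F.L ^ (j + 1) : ℕ) : ZMod ((F.P K).sitesPerDir 0))).val < 17 * F.L ^ (j + 1)) then GaugeGroup.dist1 (U b * (GaugeField.gaugeAct k U' b)⁻¹) ^ 2 else 0)) → Real.sqrt (∑ b : PBond (F.P K) 0, if (∀ k, (b.src k - ((((a.src k).val * F.L ^ (j + 1) : ℕ)) : ZMod ((F.P K).sitesPerDir 0)) + ((8 * F.L ^ (j + 1)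 : ℕ) : ZMod ((F.P K).sitesPerDir 0))).val < 17 * F.L ^ (j + 1)) ∧ (∀ k, (b.tgt k - ((((a.src k).val * F.L ^ (j + 1) : ℕ)) : ZMod ((F.P K).sitesPerDir 0)) + ((8 * F.L ^ (j + 1) : ℕ) : ZMod ((F.P K).sitesPerDir 0))).val < 17 * F.L ^ (j + 1)) then GaugeGroup.dist1 (U b * (U' b)⁻¹) ^ 2 else 0) ≤ T * Real.sqrt ((F.L : ℝ) ^ (j + 1)) * T3UnitScaleTilt.θBal F.L γ b₀ p₀ (K - j) → ∃ m : ℕ → ℕ, (∀ i, m i ≤ m (i + 1)) ∧ m j ≤ F.L ^ (j + 1) ∧ ∃ σ : ℕ → ℝ, (∀ i, i < j → 0 ≤ σ i ∧ σ i ≤ 1 / (2 * 10 ^ 7 * (L : ℝ) ^ 4)) ∧ (∑ i ∈ Finset.range j, σ i ≤ 1 / (2 * 10 ^ 7 * (L : ℝ) ^ 7)) ∧ ∀ i, i < j → ∀ h : GaugeTransf (F.P K) i (Matrix.specialUnitaryGroup (Fin 2) ℂ), (∀ k' : GaugeTransf (F.P K) i (Matrix.specialUnitaryGroup (Fin 2)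 ℂ), (∑ b : PBond (F.P K) i, if b ∈ Finset.univ.filter (fun b : PBond (F.P K) i => Site.tdist (fun k => ((((b.src k).val * F.L ^ i : ℕ)) : ZMod ((F.P K).sitesPerDir 0))) (fun k => ((((a.src k).val * F.L ^ (j + 1) : ℕ)) : ZMod ((F.P K).sitesPerDir 0))) + 2 * F.L ^ (i + 1) + m i ≤ 8 * F.L ^ (j + 1)) then GaugeGroup.dist1 (Averaging.iter (fun i' => BlockAveraging.blockAvg (P := F.P K) (j := i') T3UnitLawDensityEML.ℰp) i U b * (GaugeField.gaugeAct h (Averaging.iter (fun i' => BlockAveraging.blockAvg (P := F.P K) (j := i') T3UnitLawDensityEML.ℰp) i U') b)⁻¹) ^ 2 else 0) ≤ ∑ b : PBond (F.P K) i, if b ∈ Finset.univ.filter (fun b : PBond (F.P K) i => Site.tdist (fun k => ((((b.src k).val * F.L ^ i : ℕ)) : ZMod ((F.P K).sitesPerDir 0))) (fun k => ((((a.src k).val * F.L ^ (j + 1) : ℕ)) : ZMod ((F.P K).sitesPerDir 0))) + 2 * F.L ^ (i + 1) + m i ≤ 8 * F.L ^ (j + 1)) then GaugeGroup.dist1 (Averaging.iter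 (fun i' => BlockAveraging.blockAvg (P := F.P K) (j := i') T3UnitLawDensityEML.ℰp) i U b * (GaugeField.gaugeAct k' (GaugeField.gaugeAct h (Averaging.iter (fun i' => BlockAveraging.blockAvg (P := F.P K) (j := i') T3UnitLawDensityEML.ℰp) i U')) b)⁻¹) ^ 2 else 0) → ∑ b ∈ Finset.univ.filter (fun b : PBond (F.P K) i => Site.tdist (fun k => ((((b.src k).val * F.L ^ i : ℕ)) : ZMod ((F.P K).sitesPerDir 0))) (fun k => ((((a.src k).val * F.L ^ (j + 1) : ℕ)) : ZMod ((F.P K).sitesPerDir 0))) + 2 * F.L ^ (i + 1) + m i ≤ 8 * F.L ^ (j + 1)), ‖BlockAveragingEMLLinearisedBackground.pertVar (Averaging.iter (fun i' => BlockAveraging.blockAvg (P := F.P K) (j := i') T3UnitLawDensityEML.ℰp) i U) (GaugeField.gaugeAct h (Averaging.iter (fun i' => BlockAveraging.blockAvg (P := F.P K) (j := i') T3UnitLawDensityEML.ℰp) i U')) b‖ ^ 2 ≤ 4 * ((F.L : ℝ) ^ i)⁻¹ * (∑ b : PBond (F.P K) 0, if (∀ k, (b.src k - ((((a.src k).val *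 F.L ^ (j + 1) : ℕ)) : ZMod ((F.P K).sitesPerDir 0)) + ((8 * F.L ^ (j + 1) : ℕ) : ZMod ((F.P K).sitesPerDir 0))).val < 17 * F.L ^ (j + 1)) ∧ (∀ k, (b.tgt k - ((((a.src k).val * F.L ^ (j + 1) : ℕ)) : ZMod ((F.P K).sitesPerDir 0)) + ((8 * F.L ^ (j + 1) : ℕ) : ZMod ((F.P K).sitesPerDir 0))).val < 17 * F.L ^ (j + 1)) then GaugeGroup.dist1 (U b * (U' b)⁻¹) ^ 2 else 0) → (1 / (10 ^ 8 * (L : ℝ) ^ 7)) ^ 2 * (4 / 9) ^ i < 4 * ((F.L : ℝ) ^ i)⁻¹ * (∑ b : PBond (F.P K) 0, if (∀ k, (b.src k - ((((a.src k).val * F.L ^ (j + 1) : ℕ)) : ZMod ((F.P K).sitesPerDir 0)) + ((8 * F.L ^ (j + 1) : ℕ) : ZMod ((F.P K).sitesPerDir 0))).val < 17 * F.L ^ (j + 1)) ∧ (∀ k, (b.tgt k - ((((a.src k).val * F.L ^ (j + 1) : ℕ)) : ZMod ((F.P K).sitesPerDir 0)) + ((8 * F.L ^ (j + 1) : ℕ)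 : ZMod ((F.P K).sitesPerDir 0))).val < 17 * F.L ^ (j + 1)) then GaugeGroup.dist1 (U b * (U' b)⁻¹) ^ 2 else 0) → ∀ c ∈ Finset.univ.filter (fun b : PBond (F.P K) (i + 1) => Site.tdist (fun k => ((((b.src k).val * F.L ^ (i + 1) : ℕ)) : ZMod ((F.P K).sitesPerDir 0))) (fun k => ((((a.src k).val * F.L ^ (j + 1) : ℕ)) : ZMod ((F.P K).sitesPerDir 0))) + 2 * F.L ^ (i + 1 + 1) + m (i + 1) ≤ 8 * F.L ^ (j + 1)), ∀ b ∈ Finset.univ.filter (fun b : PBond (F.P K) i => blockOf b.src = c.src ∨ blockOf b.src = c.tgt), ‖BlockAveragingEMLLinearisedBackground.pertVar (Averaging.iter (fun i' => BlockAveraging.blockAvg (P := F.P K) (j := i') T3UnitLawDensityEML.ℰp) i U) (GaugeField.gaugeAct h (Averaging.iter (fun i' => BlockAveraging.blockAvg (P := F.P K) (j := i') T3UnitLawDensityEML.ℰp) i U')) b‖ ≤ σ i) :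
    open Literature.MathematicalPhysics.QuantumFieldTheory.Balaban1983to89 Literature.MathematicalPhysics.QuantumFieldTheory.Balaban1983to89.T3ContinuumYM3Torus in ∀ (L : ℕ), ∃ T : ℝ, 0 < T ∧ ∀ (b₀ p₀ : ℝ), 0 < b₀ → 2 < p₀ → ∃ γ₂ : ℝ, 0 < γ₂ ∧ ∀ (F : T3Family) (γ : ℝ), F.L = L → 0 < γ → γ ≤ γ₂ → ∀ (K j : ℕ), 1 ≤ j → j + 3 ≤ K → ∀ (a : Plaq (F.P K) (j + 1)) (U U' : GaugeField (F.P K) 0 (Matrix.specialUnitaryGroup (Fin 2) ℂ)), (∀ (i : ℕ) (q : Plaq (F.P K) i), i < j + 1 → Site.tdist (fun k => ((((q.src k).val * F.L ^ i : ℕ)) : ZMod ((F.P K).sitesPerDir 0))) (fun k => ((((a.src k).val * F.L ^ (j + 1) : ℕ)) : ZMod ((F.P K).sitesPerDir 0))) + 64 * F.L ^ i ≤ 64 * F.L ^ (j + 1) → GaugeGroup.dist1 (GaugeField.plaqHol (Averaging.iter (fun i' => BlockAveraging.blockAvg (P := F.P K) (j := i') T3UnitLawDensityEML.ℰp) i U)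 q) < T3UnitScaleTilt.θBal F.L γ b₀ p₀ (K - i)) → (∀ (i : ℕ) (q : Plaq (F.P K) i), i < j + 1 → Site.tdist (fun k => ((((q.src k).val * F.L ^ i : ℕ)) : ZMod ((F.P K).sitesPerDir 0))) (fun k => ((((a.src k).val * F.L ^ (j + 1) : ℕ)) : ZMod ((F.P K).sitesPerDir 0))) + 64 * F.L ^ i ≤ 64 * F.L ^ (j + 1) → GaugeGroup.dist1 (GaugeField.plaqHol (Averaging.iter (fun i' => BlockAveraging.blockAvg (P := F.P K) (j := i') T3UnitLawDensityEML.ℰp) i U') q) < T3UnitScaleTilt.θBal F.L γ b₀ p₀ (K - i)) → (∀ k : GaugeTransf (F.P K) 0 (Matrix.specialUnitaryGroup (Fin 2) ℂ), (∑ b : PBond (F.P K) 0, if (∀ k, (b.src k - ((((a.src k).val * F.L ^ (j + 1) : ℕ)) : ZMod ((F.P K).sitesPerDir 0)) + ((8 * F.L ^ (j + 1) : ℕ) : ZMod ((F.P K).sitesPerDir 0))).val < 17 * F.L ^ (j + 1)) ∧ (∀ k, (b.tgt k - ((((a.src k).val * F.L ^ (j + 1) : ℕ)) : ZMod ((F.P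 K).sitesPerDir 0)) + ((8 * F.L ^ (j + 1) : ℕ) : ZMod ((F.P K).sitesPerDir 0))).val < 17 * F.L ^ (j + 1)) then GaugeGroup.dist1 (U b * (U' b)⁻¹) ^ 2 else 0) ≤ (∑ b : PBond (F.P K) 0, if (∀ k, (b.src k - ((((a.src k).val * F.L ^ (j + 1) : ℕ)) : ZMod ((F.P K).sitesPerDir 0)) + ((8 * F.L ^ (j + 1) : ℕ) : ZMod ((F.P K).sitesPerDir 0))).val < 17 * F.L ^ (j + 1)) ∧ (∀ k, (b.tgt k - ((((a.src k).val * F.L ^ (j + 1) : ℕ)) : ZMod ((F.P K).sitesPerDir 0)) + ((8 * F.L ^ (j + 1) : ℕ) : ZMod ((F.P K).sitesPerDir 0))).val < 17 * F.L ^ (j + 1)) then GaugeGroup.dist1 (U b * (GaugeField.gaugeAct k U' b)⁻¹) ^ 2 else 0)) → Real.sqrt (∑ b : PBond (F.P K) 0, if (∀ k, (b.src k - ((((a.src k).val * F.L ^ (j + 1) : ℕ)) : ZMod ((F.P K).sitesPerDir 0)) + ((8 * F.L ^ (j + 1) : ℕ) : ZMod ((F.P K).sitesPerDir 0))).val < 17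 * F.L ^ (j + 1)) ∧ (∀ k, (b.tgt k - ((((a.src k).val * F.L ^ (j + 1) : ℕ)) : ZMod ((F.P K).sitesPerDir 0)) + ((8 * F.L ^ (j + 1) : ℕ) : ZMod ((F.P K).sitesPerDir 0))).val < 17 * F.L ^ (j + 1)) then GaugeGroup.dist1 (U b * (U' b)⁻¹) ^ 2 else 0) ≤ T * Real.sqrt ((F.L : ℝ) ^ (j + 1)) * T3UnitScaleTilt.θBal F.L γ b₀ p₀ (K - j) → ∃ m : ℕ → ℕ, (∀ i, m i ≤ m (i + 1)) ∧ m j ≤ F.L ^ (j + 1) ∧ ∃ σ : ℕ → ℝ, (∀ i, i < j → 0 ≤ σ i ∧ σ i ≤ 1 / (2 * 10 ^ 7 * (L : ℝ) ^ 4)) ∧ (∑ i ∈ Finset.range j, σ i ≤ 1 / (2 * 10 ^ 7 * (L : ℝ) ^ 7)) ∧ ∀ i, i < j → ∀ h : GaugeTransf (F.P K) i (Matrix.specialUnitaryGroup (Fin 2) ℂ), (∀ k' : GaugeTransf (F.P K) i (Matrix.specialUnitaryGroup (Fin 2) ℂ), (∑ b : PBond (F.P K) i, if b ∈ Finset.univ.filter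 (fun b : PBond (F.P K) i => Site.tdist (fun k => ((((b.src k).val * F.L ^ i : ℕ)) : ZMod ((F.P K).sitesPerDir 0))) (fun k => ((((a.src k).val * F.L ^ (j + 1) : ℕ)) : ZMod ((F.P K).sitesPerDir 0))) + 2 * F.L ^ (i + 1) + m i ≤ 8 * F.L ^ (j + 1)) then GaugeGroup.dist1 (Averaging.iter (fun i' => BlockAveraging.blockAvg (P := F.P K) (j := i') T3UnitLawDensityEML.ℰp) i U b * (GaugeField.gaugeAct h (Averaging.iter (fun i' => BlockAveraging.blockAvg (P := F.P K) (j := i') T3UnitLawDensityEML.ℰp) i U') b)⁻¹) ^ 2 else 0) ≤ ∑ b : PBond (F.P K) i, if b ∈ Finset.univ.filter (fun b : PBond (F.P K) i => Site.tdist (fun k => ((((b.src k).val * F.L ^ i : ℕ)) : ZMod ((F.P K).sitesPerDir 0))) (fun k => ((((a.src k).val * F.L ^ (j + 1) : ℕ)) : ZMod ((F.P K).sitesPerDir 0))) + 2 * F.L ^ (i + 1) + m i ≤ 8 * F.L ^ (j + 1)) then GaugeGroup.dist1 (Averaging.iter (fun i' => BlockAveraging.blockAvg (P := F.P K) (j :=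 i') T3UnitLawDensityEML.ℰp) i U b * (GaugeField.gaugeAct k' (GaugeField.gaugeAct h (Averaging.iter (fun i' => BlockAveraging.blockAvg (P := F.P K) (j := i') T3UnitLawDensityEML.ℰp) i U')) b)⁻¹) ^ 2 else 0) → ∑ b ∈ Finset.univ.filter (fun b : PBond (F.P K) i => Site.tdist (fun k => ((((b.src k).val * F.L ^ i : ℕ)) : ZMod ((F.P K).sitesPerDir 0))) (fun k => ((((a.src k).val * F.L ^ (j + 1) : ℕ)) : ZMod ((F.P K).sitesPerDir 0))) + 2 * F.L ^ (i + 1) + m i ≤ 8 * F.L ^ (j + 1)), ‖BlockAveragingEMLLinearisedBackground.pertVar (Averaging.iter (fun i' => BlockAveraging.blockAvg (P := F.P K) (j := i') T3UnitLawDensityEML.ℰp) i U) (GaugeField.gaugeAct h (Averaging.iter (fun i' => BlockAveraging.blockAvg (P := F.P K) (j := i') T3UnitLawDensityEML.ℰp) i U')) b‖ ^ 2 ≤ 4 * ((F.L : ℝ) ^ i)⁻¹ * (∑ b : PBond (F.P K) 0, if (∀ k, (b.src k - ((((a.src k).val * F.L ^ (j + 1) : ℕ)) : ZMod ((F.P K).sitesPerDir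 0)) + ((8 * F.L ^ (j + 1) : ℕ) : ZMod ((F.P K).sitesPerDir 0))).val < 17 * F.L ^ (j + 1)) ∧ (∀ k, (b.tgt k - ((((a.src k).val * F.L ^ (j + 1) : ℕ)) : ZMod ((F.P K).sitesPerDir 0)) + ((8 * F.L ^ (j + 1) : ℕ) : ZMod ((F.P K).sitesPerDir 0))).val < 17 * F.L ^ (j + 1)) then GaugeGroup.dist1 (U b * (U' b)⁻¹) ^ 2 else 0) → (1 / (10 ^ 8 * (L : ℝ) ^ 7)) ^ 2 * (4 / 9) ^ i < 4 * ((F.L : ℝ) ^ i)⁻¹ * (∑ b : PBond (F.P K) 0, if (∀ k, (b.src k - ((((a.src k).val * F.L ^ (j + 1) : ℕ)) : ZMod ((F.P K).sitesPerDir 0)) + ((8 * F.L ^ (j + 1) : ℕ) : ZMod ((F.P K).sitesPerDir 0))).val < 17 * F.L ^ (j + 1)) ∧ (∀ k, (b.tgt k - ((((a.src k).val * F.L ^ (j + 1) : ℕ)) : ZMod ((F.P K).sitesPerDir 0)) + ((8 * F.L ^ (j + 1) : ℕ) : ZMod ((F.P K).sitesPerDir 0))).val < 17 * F.L ^ (j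 + 1)) then GaugeGroup.dist1 (U b * (U' b)⁻¹) ^ 2 else 0) → ∀ c ∈ Finset.univ.filter (fun b : PBond (F.P K) (i + 1) => Site.tdist (fun k => ((((b.src k).val * F.L ^ (i + 1) : ℕ)) : ZMod ((F.P K).sitesPerDir 0))) (fun k => ((((a.src k).val * F.L ^ (j + 1) : ℕ)) : ZMod ((F.P K).sitesPerDir 0))) + 2 * F.L ^ (i + 1 + 1) + m (i + 1) ≤ 8 * F.L ^ (j + 1)), ∀ b ∈ Finset.univ.filter (fun b : PBond (F.P K) i => blockOf b.src = c.src ∨ blockOf b.src = c.tgt), ‖BlockAveragingEMLLinearisedBackground.pertVar (Averaging.iter (fun i' => BlockAveraging.blockAvg (P := F.P K) (j := i') T3UnitLawDensityEML.ℰp) i U) (GaugeField.gaugeAct h (Averaging.iter (fun i' => BlockAveraging.blockAvg (P := F.P K) (j := i') T3UnitLawDensityEML.ℰp) i U')) b‖ ≤ σ i := by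
  intro L
  obtain ⟨T, hT, HD⟩ := hDeep L
  refine ⟨T, hT, ?_⟩
  intro b₀ p₀ hb hp
  obtain ⟨γ₂, hγ₂, HD'⟩ := HD b₀ p₀ hb hp
  by_cases hL1 : 1 ≤ L
  swap
  · -- `L = 0`: no `T3Family` has `F.L = L` (`F.L ≥ 3`); any `γ₂` serves
    refine ⟨γ₂, hγ₂, ?_⟩
    intro F γ hFL
    exfalso
    have hL3 : 3 ≤ F.L := (by obtain ⟨k, hk⟩ := F.hL.1; have := F.hL.2; omega)
    omega
  obtain ⟨γ₃, hγ₃, hγ₃1, hsmall⟩ := near_shallow_four_Bx_le (L := L) hL1 hb (by linarith : (0 : ℝ) < p₀) hT.le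
    (τ := 1 / (10 ^ 8 * (L : ℝ) ^ 7)) (by positivity)
  refine ⟨min γ₂ γ₃, lt_min hγ₂ hγ₃, ?_⟩
  intro F γ hFL hγ hγle K j hj1 hjK a U U' hU hU' hmin0 hnear
  by_cases hdeep : K < 3 * (j + 1)
  · exact HD' F γ hFL hγ (hγle.trans (min_le_left _ _)) K j hj1 hjK hdeep a U U' hU hU' hmin0 hnear
  · -- shallow: small data, no low level
    have hL3 : 3 ≤ F.L := (by obtain ⟨k, hk⟩ := F.hL.1; have := F.hL.2; omega)
    have hLr : (3 : ℝ) ≤ (F.L : ℝ) := by exact_mod_cast hL3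
    obtain ⟨Bx, hBx⟩ : ∃ Bx : ℝ, Bx = ∑ b : PBond (F.P K) 0, if (∀ k, (b.src k - ((((a.src k).val * F.L ^ (j + 1) : ℕ)) : ZMod ((F.P K).sitesPerDir 0)) + ((8 * F.L ^ (j + 1) : ℕ) : ZMod ((F.P K).sitesPerDir 0))).val < 17 * F.L ^ (j + 1)) ∧ (∀ k, (b.tgt k - ((((a.src k).val * F.L ^ (j + 1) : ℕ)) : ZMod ((F.P K).sitesPerDir 0)) + ((8 * F.L ^ (j + 1) : ℕ) : ZMod ((F.P K).sitesPerDir 0))).val < 17 * F.L ^ (j + 1)) then GaugeGroup.dist1 (U b * (U' b)⁻¹) ^ 2 else 0 := ⟨_, rfl⟩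
    rw [← hBx] at hnear ⊢
    have hBx0 : 0 ≤ Bx := by rw [hBx]; exact Finset.sum_nonneg fun b _ => by split_ifs <;> positivity
    have h4 : 4 * Bx ≤ (1 / (10 ^ 8 * (L : ℝ) ^ 7)) ^ 2 :=
      hsmall γ hγ (hγle.trans (min_le_right _ _)) K j (by omega) Bx hBx0 (by rw [hFL] at hnear; exact hnear)
    refine ⟨fun _ => 0, fun _ => le_rfl, Nat.zero_le _, fun _ => 0, fun i _ => ⟨le_rfl, by positivity⟩, ?_, ?_⟩
    · simp only [Finset.sum_const_zero]; positivity
    · intro i hi h hmin hsq hlow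
      exact absurd hlow (not_low_of_four_Bx_le hLr hBx0 h4 i)

/-! ## §3 h⋆ and the registered stub from the deep low-level charts -/

/-- ★★★ **hStab⋆'s ROW FROM THE DEEP LOW-LEVEL CHARTS** (§2 ∘ ✓`avgStability_star_of_lowCharts`). [cite: Balaban1985Averaging, Props 1-3 (122)-(126) p.36] -/
theorem avgStability_star_of_deepLowCharts
    (hDeep : open Literature.MathematicalPhysics.QuantumFieldTheory.Balaban1983to89 Literature.MathematicalPhysics.QuantumFieldTheory.Balaban1983to89.T3ContinuumYM3Torus in ∀ (L : ℕ), ∃ T : ℝ, 0 < T ∧ ∀ (b₀ p₀ : ℝ), 0 < b₀ → 2 < p₀ → ∃ γ₂ : ℝ, 0 < γ₂ ∧ ∀ (F : T3Family) (γ : ℝ), F.L = L → 0 < γ → γ ≤ γ₂ → ∀ (K j : ℕ), 1 ≤ j → j + 3 ≤ K → K < 3 * (j + 1) → ∀ (a : Plaq (F.P K) (j + 1)) (U U' : GaugeField (F.P K) 0 (Matrix.specialUnitaryGroup (Fin 2) ℂ)), (∀ (i : ℕ) (q : Plaq (F.P K) i), i < j + 1 → Site.tdist (fun k => ((((q.src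 k).val * F.L ^ i : ℕ)) : ZMod ((F.P K).sitesPerDir 0))) (fun k => ((((a.src k).val * F.L ^ (j + 1) : ℕ)) : ZMod ((F.P K).sitesPerDir 0))) + 64 * F.L ^ i ≤ 64 * F.L ^ (j + 1) → GaugeGroup.dist1 (GaugeField.plaqHol (Averaging.iter (fun i' => BlockAveraging.blockAvg (P := F.P K) (j := i') T3UnitLawDensityEML.ℰp) i U) q) < T3UnitScaleTilt.θBal F.L γ b₀ p₀ (K - i)) → (∀ (i : ℕ) (q : Plaq (F.P K) i), i < j + 1 → Site.tdist (fun k => ((((q.src k).val * F.L ^ i : ℕ)) : ZMod ((F.P K).sitesPerDir 0))) (fun k => ((((a.src k).val * F.L ^ (j + 1) : ℕ)) : ZMod ((F.P K).sitesPerDir 0))) + 64 * F.L ^ i ≤ 64 * F.L ^ (j + 1) → GaugeGroup.dist1 (GaugeField.plaqHol (Averaging.iter (fun i' => BlockAveraging.blockAvg (P := F.P K) (j := i') T3UnitLawDensityEML.ℰp) i U') q) < T3UnitScaleTilt.θBal F.L γ b₀ p₀ (K - i)) → (∀ k : GaugeTransf (F.P K) 0 (Matrix.specialUnitaryGroup (Fin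 2) ℂ), (∑ b : PBond (F.P K) 0, if (∀ k, (b.src k - ((((a.src k).val * F.L ^ (j + 1) : ℕ)) : ZMod ((F.P K).sitesPerDir 0)) + ((8 * F.L ^ (j + 1) : ℕ) : ZMod ((F.P K).sitesPerDir 0))).val < 17 * F.L ^ (j + 1)) ∧ (∀ k, (b.tgt k - ((((a.src k).val * F.L ^ (j + 1) : ℕ)) : ZMod ((F.P K).sitesPerDir 0)) + ((8 * F.L ^ (j + 1) : ℕ) : ZMod ((F.P K).sitesPerDir 0))).val < 17 * F.L ^ (j + 1)) then GaugeGroup.dist1 (U b * (U' b)⁻¹) ^ 2 else 0) ≤ (∑ b : PBond (F.P K) 0, if (∀ k, (b.src k - ((((a.src k).val * F.L ^ (j + 1) : ℕ)) : ZMod ((F.P K).sitesPerDir 0)) + ((8 * F.L ^ (j + 1) : ℕ) : ZMod ((F.P K).sitesPerDir 0))).val < 17 * F.L ^ (j + 1)) ∧ (∀ k, (b.tgt k - ((((a.src k).val * F.L ^ (j + 1) : ℕ)) : ZMod ((F.P K).sitesPerDir 0)) + ((8 * F.L ^ (j + 1) : ℕ) : ZMod ((F.P K).sitesPerDir 0))).val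 < 17 * F.L ^ (j + 1)) then GaugeGroup.dist1 (U b * (GaugeField.gaugeAct k U' b)⁻¹) ^ 2 else 0)) → Real.sqrt (∑ b : PBond (F.P K) 0, if (∀ k, (b.src k - ((((a.src k).val * F.L ^ (j + 1) : ℕ)) : ZMod ((F.P K).sitesPerDir 0)) + ((8 * F.L ^ (j + 1) : ℕ) : ZMod ((F.P K).sitesPerDir 0))).val < 17 * F.L ^ (j + 1)) ∧ (∀ k, (b.tgt k - ((((a.src k).val * F.L ^ (j + 1) : ℕ)) : ZMod ((F.P K).sitesPerDir 0)) + ((8 * F.L ^ (j + 1) : ℕ) : ZMod ((F.P K).sitesPerDir 0))).val < 17 * F.L ^ (j + 1)) then GaugeGroup.dist1 (U b * (U' b)⁻¹) ^ 2 else 0) ≤ T * Real.sqrt ((F.L : ℝ) ^ (j + 1)) * T3UnitScaleTilt.θBal F.L γ b₀ p₀ (K - j) → ∃ m : ℕ → ℕ, (∀ i, m i ≤ m (i + 1)) ∧ m j ≤ F.L ^ (j + 1) ∧ ∃ σ : ℕ → ℝ, (∀ i, i < j → 0 ≤ σ i ∧ σ i ≤ 1 / (2 * 10 ^ 7 * (L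 : ℝ) ^ 4)) ∧ (∑ i ∈ Finset.range j, σ i ≤ 1 / (2 * 10 ^ 7 * (L : ℝ) ^ 7)) ∧ ∀ i, i < j → ∀ h : GaugeTransf (F.P K) i (Matrix.specialUnitaryGroup (Fin 2) ℂ), (∀ k' : GaugeTransf (F.P K) i (Matrix.specialUnitaryGroup (Fin 2) ℂ), (∑ b : PBond (F.P K) i, if b ∈ Finset.univ.filter (fun b : PBond (F.P K) i => Site.tdist (fun k => ((((b.src k).val * F.L ^ i : ℕ)) : ZMod ((F.P K).sitesPerDir 0))) (fun k => ((((a.src k).val * F.L ^ (j + 1) : ℕ)) : ZMod ((F.P K).sitesPerDir 0))) + 2 * F.L ^ (i + 1) + m i ≤ 8 * F.L ^ (j + 1)) then GaugeGroup.dist1 (Averaging.iter (fun i' => BlockAveraging.blockAvg (P := F.P K) (j := i') T3UnitLawDensityEML.ℰp) i U b * (GaugeField.gaugeAct h (Averaging.iter (fun i' => BlockAveraging.blockAvg (P := F.P K) (j := i') T3UnitLawDensityEML.ℰp) i U') b)⁻¹) ^ 2 else 0) ≤ ∑ b : PBond (F.P K) i, if b ∈ Finset.univ.filter (fun b : PBond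 (F.P K) i => Site.tdist (fun k => ((((b.src k).val * F.L ^ i : ℕ)) : ZMod ((F.P K).sitesPerDir 0))) (fun k => ((((a.src k).val * F.L ^ (j + 1) : ℕ)) : ZMod ((F.P K).sitesPerDir 0))) + 2 * F.L ^ (i + 1) + m i ≤ 8 * F.L ^ (j + 1)) then GaugeGroup.dist1 (Averaging.iter (fun i' => BlockAveraging.blockAvg (P := F.P K) (j := i') T3UnitLawDensityEML.ℰp) i U b * (GaugeField.gaugeAct k' (GaugeField.gaugeAct h (Averaging.iter (fun i' => BlockAveraging.blockAvg (P := F.P K) (j := i') T3UnitLawDensityEML.ℰp) i U')) b)⁻¹) ^ 2 else 0) → ∑ b ∈ Finset.univ.filter (fun b : PBond (F.P K) i => Site.tdist (fun k => ((((b.src k).val * F.L ^ i : ℕ)) : ZMod ((F.P K).sitesPerDir 0))) (fun k => ((((a.src k).val * F.L ^ (j + 1) : ℕ)) : ZMod ((F.P K).sitesPerDir 0))) + 2 * F.L ^ (i + 1) + m i ≤ 8 * F.L ^ (j + 1)), ‖BlockAveragingEMLLinearisedBackground.pertVar (Averaging.iter (fun i' => BlockAveraging.blockAvg (P := F.P K)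 (j := i') T3UnitLawDensityEML.ℰp) i U) (GaugeField.gaugeAct h (Averaging.iter (fun i' => BlockAveraging.blockAvg (P := F.P K) (j := i') T3UnitLawDensityEML.ℰp) i U')) b‖ ^ 2 ≤ 4 * ((F.L : ℝ) ^ i)⁻¹ * (∑ b : PBond (F.P K) 0, if (∀ k, (b.src k - ((((a.src k).val * F.L ^ (j + 1) : ℕ)) : ZMod ((F.P K).sitesPerDir 0)) + ((8 * F.L ^ (j + 1) : ℕ) : ZMod ((F.P K).sitesPerDir 0))).val < 17 * F.L ^ (j + 1)) ∧ (∀ k, (b.tgt k - ((((a.src k).val * F.L ^ (j + 1) : ℕ)) : ZMod ((F.P K).sitesPerDir 0)) + ((8 * F.L ^ (j + 1) : ℕ) : ZMod ((F.P K).sitesPerDir 0))).val < 17 * F.L ^ (j + 1)) then GaugeGroup.dist1 (U b * (U' b)⁻¹) ^ 2 else 0) → (1 / (10 ^ 8 * (L : ℝ) ^ 7)) ^ 2 * (4 / 9) ^ i < 4 * ((F.L : ℝ) ^ i)⁻¹ * (∑ b : PBond (F.P K) 0, if (∀ k, (b.src k - ((((a.src k).val * F.L ^ (j + 1) : ℕ))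 : ZMod ((F.P K).sitesPerDir 0)) + ((8 * F.L ^ (j + 1) : ℕ) : ZMod ((F.P K).sitesPerDir 0))).val < 17 * F.L ^ (j + 1)) ∧ (∀ k, (b.tgt k - ((((a.src k).val * F.L ^ (j + 1) : ℕ)) : ZMod ((F.P K).sitesPerDir 0)) + ((8 * F.L ^ (j + 1) : ℕ) : ZMod ((F.P K).sitesPerDir 0))).val < 17 * F.L ^ (j + 1)) then GaugeGroup.dist1 (U b * (U' b)⁻¹) ^ 2 else 0) → ∀ c ∈ Finset.univ.filter (fun b : PBond (F.P K) (i + 1) => Site.tdist (fun k => ((((b.src k).val * F.L ^ (i + 1) : ℕ)) : ZMod ((F.P K).sitesPerDir 0))) (fun k => ((((a.src k).val * F.L ^ (j + 1) : ℕ)) : ZMod ((F.P K).sitesPerDir 0))) + 2 * F.L ^ (i + 1 + 1) + m (i + 1) ≤ 8 * F.L ^ (j + 1)), ∀ b ∈ Finset.univ.filter (fun b : PBond (F.P K) i => blockOf b.src = c.src ∨ blockOf b.src = c.tgt), ‖BlockAveragingEMLLinearisedBackground.pertVar (Averaging.iter (fun i' => BlockAveraging.blockAvg (P := F.P K) (j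 := i') T3UnitLawDensityEML.ℰp) i U) (GaugeField.gaugeAct h (Averaging.iter (fun i' => BlockAveraging.blockAvg (P := F.P K) (j := i') T3UnitLawDensityEML.ℰp) i U')) b‖ ≤ σ i) :
    open Literature.MathematicalPhysics.QuantumFieldTheory.Balaban1983to89 Literature.MathematicalPhysics.QuantumFieldTheory.Balaban1983to89.T3ContinuumYM3Torus in ∀ (L : ℕ), ∃ T : ℝ, 0 < T ∧ ∃ CS : ℝ, 0 ≤ CS ∧ ∀ (b₀ p₀ : ℝ), 0 < b₀ → 2 < p₀ → ∃ γ₁ : ℝ, 0 < γ₁ ∧ γ₁ ≤ 1 ∧ ∀ (F : T3Family) (γ : ℝ), F.L = L → 0 < γ → γ ≤ γ₁ → ∀ (K j : ℕ), 1 ≤ j → j + 3 ≤ K → ∀ (a : Plaq (F.P K) (j + 1)) (U U' : GaugeField (F.P K) 0 (Matrix.specialUnitaryGroup (Fin 2) ℂ)), (∀ (i : ℕ) (q : Plaq (F.P K) i), i < j + 1 → Site.tdist (fun k => ((((q.src k).val * F.L ^ i : ℕ)) : ZMod ((F.P K).sitesPerDir 0))) (fun k => ((((a.src k).val * F.L ^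 (j + 1) : ℕ)) : ZMod ((F.P K).sitesPerDir 0))) + 64 * F.L ^ i ≤ 64 * F.L ^ (j + 1) → GaugeGroup.dist1 (GaugeField.plaqHol (Averaging.iter (fun i' => BlockAveraging.blockAvg (P := F.P K) (j := i') T3UnitLawDensityEML.ℰp) i U) q) < T3UnitScaleTilt.θBal F.L γ b₀ p₀ (K - i)) → (∀ (i : ℕ) (q : Plaq (F.P K) i), i < j + 1 → Site.tdist (fun k => ((((q.src k).val * F.L ^ i : ℕ)) : ZMod ((F.P K).sitesPerDir 0))) (fun k => ((((a.src k).val * F.L ^ (j + 1) : ℕ)) : ZMod ((F.P K).sitesPerDir 0))) + 64 * F.L ^ i ≤ 64 * F.L ^ (j + 1) → GaugeGroup.dist1 (GaugeField.plaqHol (Averaging.iter (fun i' => BlockAveraging.blockAvg (P := F.P K) (j := i') T3UnitLawDensityEML.ℰp) i U') q) < T3UnitScaleTilt.θBal F.L γ b₀ p₀ (K - i)) → (∀ k : GaugeTransf (F.P K) 0 (Matrix.specialUnitaryGroup (Fin 2) ℂ), (∑ b : PBond (F.P K) 0, if (∀ k, (b.src k - ((((a.src k).val * F.L ^ (j + 1)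 : ℕ)) : ZMod ((F.P K).sitesPerDir 0)) + ((8 * F.L ^ (j + 1) : ℕ) : ZMod ((F.P K).sitesPerDir 0))).val < 17 * F.L ^ (j + 1)) ∧ (∀ k, (b.tgt k - ((((a.src k).val * F.L ^ (j + 1) : ℕ)) : ZMod ((F.P K).sitesPerDir 0)) + ((8 * F.L ^ (j + 1) : ℕ) : ZMod ((F.P K).sitesPerDir 0))).val < 17 * F.L ^ (j + 1)) then GaugeGroup.dist1 (U b * (U' b)⁻¹) ^ 2 else 0) ≤ (∑ b : PBond (F.P K) 0, if (∀ k, (b.src k - ((((a.src k).val * F.L ^ (j + 1) : ℕ)) : ZMod ((F.P K).sitesPerDir 0)) + ((8 * F.L ^ (j + 1) : ℕ) : ZMod ((F.P K).sitesPerDir 0))).val < 17 * F.L ^ (j + 1)) ∧ (∀ k, (b.tgt k - ((((a.src k).val * F.L ^ (j + 1) : ℕ)) : ZMod ((F.P K).sitesPerDir 0)) + ((8 * F.L ^ (j + 1) : ℕ) : ZMod ((F.P K).sitesPerDir 0))).val < 17 * F.L ^ (j + 1)) then GaugeGroup.dist1 (U b * (GaugeField.gaugeAct k U' b)⁻¹)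 ^ 2 else 0)) → Real.sqrt (∑ b : PBond (F.P K) 0, if (∀ k, (b.src k - ((((a.src k).val * F.L ^ (j + 1) : ℕ)) : ZMod ((F.P K).sitesPerDir 0)) + ((8 * F.L ^ (j + 1) : ℕ) : ZMod ((F.P K).sitesPerDir 0))).val < 17 * F.L ^ (j + 1)) ∧ (∀ k, (b.tgt k - ((((a.src k).val * F.L ^ (j + 1) : ℕ)) : ZMod ((F.P K).sitesPerDir 0)) + ((8 * F.L ^ (j + 1) : ℕ) : ZMod ((F.P K).sitesPerDir 0))).val < 17 * F.L ^ (j + 1)) then GaugeGroup.dist1 (U b * (U' b)⁻¹) ^ 2 else 0) ≤ T * Real.sqrt ((F.L : ℝ) ^ (j + 1)) * T3UnitScaleTilt.θBal F.L γ b₀ p₀ (K - j) → ∃ h : GaugeTransf (F.P K) j (Matrix.specialUnitaryGroup (Fin 2) ℂ), ∀ c : PBond (F.P K) (j + 1), (c = ⟨a.src, a.μ⟩ ∨ c = ⟨a.src.shift a.μ, a.ν⟩ ∨ c = ⟨a.src.shift a.ν, a.μ⟩ ∨ c = ⟨a.src, a.ν⟩) → ∀ b : PBond (F.P K) j, (blockOf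 b.src = c.src ∨ blockOf b.src = c.tgt) → (blockOf b.tgt = c.src ∨ blockOf b.tgt = c.tgt) → GaugeGroup.dist1 (Averaging.iter (fun i' => BlockAveraging.blockAvg (P := F.P K) (j := i') T3UnitLawDensityEML.ℰp) j U b * (GaugeField.gaugeAct h (Averaging.iter (fun i' => BlockAveraging.blockAvg (P := F.P K) (j := i') T3UnitLawDensityEML.ℰp) j U') b)⁻¹) ≤ CS / Real.sqrt ((F.L : ℝ) ^ (j + 1)) * Real.sqrt (∑ b : PBond (F.P K) 0, if (∀ k, (b.src k - ((((a.src k).val * F.L ^ (j + 1) : ℕ)) : ZMod ((F.P K).sitesPerDir 0)) + ((8 * F.L ^ (j + 1) : ℕ) : ZMod ((F.P K).sitesPerDir 0))).val < 17 * F.L ^ (j + 1)) ∧ (∀ k, (b.tgt k - ((((a.src k).val * F.L ^ (j + 1) : ℕ)) : ZMod ((F.P K).sitesPerDir 0)) + ((8 * F.L ^ (j + 1) : ℕ) : ZMod ((F.P K).sitesPerDir 0))).val < 17 * F.L ^ (j + 1)) then GaugeGroup.dist1 (U b * (U' b)⁻¹) ^ 2 else 0) :=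
  avgStability_star_of_lowCharts (lowCharts_of_deepLowCharts hDeep)

/-- ★★★ **`stub_iteratedLipschitz` FROM THE DEEP LOW-LEVEL CHARTS** (§2 ∘ ✓`stub_iteratedLipschitz_of_lowCharts`): the registered `j ≥ 2` stub of line
`poincare_lipschitz` holds VERBATIM once per-bond charts at the per-level box-`ℓ²`-orbit minimisers are supplied for DEEP pairs (`K < 3(j+1)`) at their
LOW levels only. [cite: Balaban1987RG1, (0.4) p.253] -/
theorem stub_iteratedLipschitz_of_deepLowCharts
    (hDeep : open Literature.MathematicalPhysics.QuantumFieldTheory.Balaban1983to89 Literature.MathematicalPhysics.QuantumFieldTheory.Balaban1983to89.T3ContinuumYM3Torus in ∀ (L : ℕ), ∃ T : ℝ, 0 < T ∧ ∀ (b₀ p₀ : ℝ), 0 < b₀ → 2 < p₀ → ∃ γ₂ : ℝ, 0 < γ₂ ∧ ∀ (F : T3Family) (γ : ℝ), F.L = L → 0 < γ → γ ≤ γ₂ → ∀ (K j : ℕ), 1 ≤ j → j + 3 ≤ K → K < 3 * (j + 1) → ∀ (a : Plaq (F.P K) (j + 1)) (U U' : GaugeField (F.P K) 0 (Matrix.specialUnitaryGroup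 (Fin 2) ℂ)), (∀ (i : ℕ) (q : Plaq (F.P K) i), i < j + 1 → Site.tdist (fun k => ((((q.src k).val * F.L ^ i : ℕ)) : ZMod ((F.P K).sitesPerDir 0))) (fun k => ((((a.src k).val * F.L ^ (j + 1) : ℕ)) : ZMod ((F.P K).sitesPerDir 0))) + 64 * F.L ^ i ≤ 64 * F.L ^ (j + 1) → GaugeGroup.dist1 (GaugeField.plaqHol (Averaging.iter (fun i' => BlockAveraging.blockAvg (P := F.P K) (j := i') T3UnitLawDensityEML.ℰp) i U) q) < T3UnitScaleTilt.θBal F.L γ b₀ p₀ (K - i)) → (∀ (i : ℕ) (q : Plaq (F.P K) i), i < j + 1 → Site.tdist (fun k => ((((q.src k).val * F.L ^ i : ℕ)) : ZMod ((F.P K).sitesPerDir 0))) (fun k => ((((a.src k).val * F.L ^ (j + 1) : ℕ)) : ZMod ((F.P K).sitesPerDir 0))) + 64 * F.L ^ i ≤ 64 * F.L ^ (j + 1) → GaugeGroup.dist1 (GaugeField.plaqHol (Averaging.iter (fun i' => BlockAveraging.blockAvg (P := F.P K) (j := i') T3UnitLawDensityEML.ℰp) i U') q) < T3UnitScaleTilt.θBal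 F.L γ b₀ p₀ (K - i)) → (∀ k : GaugeTransf (F.P K) 0 (Matrix.specialUnitaryGroup (Fin 2) ℂ), (∑ b : PBond (F.P K) 0, if (∀ k, (b.src k - ((((a.src k).val * F.L ^ (j + 1) : ℕ)) : ZMod ((F.P K).sitesPerDir 0)) + ((8 * F.L ^ (j + 1) : ℕ) : ZMod ((F.P K).sitesPerDir 0))).val < 17 * F.L ^ (j + 1)) ∧ (∀ k, (b.tgt k - ((((a.src k).val * F.L ^ (j + 1) : ℕ)) : ZMod ((F.P K).sitesPerDir 0)) + ((8 * F.L ^ (j + 1) : ℕ) : ZMod ((F.P K).sitesPerDir 0))).val < 17 * F.L ^ (j + 1)) then GaugeGroup.dist1 (U b * (U' b)⁻¹) ^ 2 else 0) ≤ (∑ b : PBond (F.P K) 0, if (∀ k, (b.src k - ((((a.src k).val * F.L ^ (j + 1) : ℕ)) : ZMod ((F.P K).sitesPerDir 0)) + ((8 * F.L ^ (j + 1) : ℕ) : ZMod ((F.P K).sitesPerDir 0))).val < 17 * F.L ^ (j + 1)) ∧ (∀ k, (b.tgt k - ((((a.src k).val * F.L ^ (j + 1) : ℕ)) : ZMod ((F.P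 K).sitesPerDir 0)) + ((8 * F.L ^ (j + 1) : ℕ) : ZMod ((F.P K).sitesPerDir 0))).val < 17 * F.L ^ (j + 1)) then GaugeGroup.dist1 (U b * (GaugeField.gaugeAct k U' b)⁻¹) ^ 2 else 0)) → Real.sqrt (∑ b : PBond (F.P K) 0, if (∀ k, (b.src k - ((((a.src k).val * F.L ^ (j + 1) : ℕ)) : ZMod ((F.P K).sitesPerDir 0)) + ((8 * F.L ^ (j + 1) : ℕ) : ZMod ((F.P K).sitesPerDir 0))).val < 17 * F.L ^ (j + 1)) ∧ (∀ k, (b.tgt k - ((((a.src k).val * F.L ^ (j + 1) : ℕ)) : ZMod ((F.P K).sitesPerDir 0)) + ((8 * F.L ^ (j + 1) : ℕ) : ZMod ((F.P K).sitesPerDir 0))).val < 17 * F.L ^ (j + 1)) then GaugeGroup.dist1 (U b * (U' b)⁻¹) ^ 2 else 0) ≤ T * Real.sqrt ((F.L : ℝ) ^ (j + 1)) * T3UnitScaleTilt.θBal F.L γ b₀ p₀ (K - j) → ∃ m : ℕ → ℕ, (∀ i, m i ≤ m (i + 1)) ∧ m j ≤ F.L ^ (j + 1) ∧ ∃ σ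 : ℕ → ℝ, (∀ i, i < j → 0 ≤ σ i ∧ σ i ≤ 1 / (2 * 10 ^ 7 * (L : ℝ) ^ 4)) ∧ (∑ i ∈ Finset.range j, σ i ≤ 1 / (2 * 10 ^ 7 * (L : ℝ) ^ 7)) ∧ ∀ i, i < j → ∀ h : GaugeTransf (F.P K) i (Matrix.specialUnitaryGroup (Fin 2) ℂ), (∀ k' : GaugeTransf (F.P K) i (Matrix.specialUnitaryGroup (Fin 2) ℂ), (∑ b : PBond (F.P K) i, if b ∈ Finset.univ.filter (fun b : PBond (F.P K) i => Site.tdist (fun k => ((((b.src k).val * F.L ^ i : ℕ)) : ZMod ((F.P K).sitesPerDir 0))) (fun k => ((((a.src k).val * F.L ^ (j + 1) : ℕ)) : ZMod ((F.P K).sitesPerDir 0))) + 2 * F.L ^ (i + 1) + m i ≤ 8 * F.L ^ (j + 1)) then GaugeGroup.dist1 (Averaging.iter (fun i' => BlockAveraging.blockAvg (P := F.P K) (j := i') T3UnitLawDensityEML.ℰp) i U b * (GaugeField.gaugeAct h (Averaging.iter (fun i' => BlockAveraging.blockAvg (P := F.P K) (j := i') T3UnitLawDensityEML.ℰp) i U')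 b)⁻¹) ^ 2 else 0) ≤ ∑ b : PBond (F.P K) i, if b ∈ Finset.univ.filter (fun b : PBond (F.P K) i => Site.tdist (fun k => ((((b.src k).val * F.L ^ i : ℕ)) : ZMod ((F.P K).sitesPerDir 0))) (fun k => ((((a.src k).val * F.L ^ (j + 1) : ℕ)) : ZMod ((F.P K).sitesPerDir 0))) + 2 * F.L ^ (i + 1) + m i ≤ 8 * F.L ^ (j + 1)) then GaugeGroup.dist1 (Averaging.iter (fun i' => BlockAveraging.blockAvg (P := F.P K) (j := i') T3UnitLawDensityEML.ℰp) i U b * (GaugeField.gaugeAct k' (GaugeField.gaugeAct h (Averaging.iter (fun i' => BlockAveraging.blockAvg (P := F.P K) (j := i') T3UnitLawDensityEML.ℰp) i U')) b)⁻¹) ^ 2 else 0) → ∑ b ∈ Finset.univ.filter (fun b : PBond (F.P K) i => Site.tdist (fun k => ((((b.src k).val * F.L ^ i : ℕ)) : ZMod ((F.P K).sitesPerDir 0))) (fun k => ((((a.src k).val * F.L ^ (j + 1) : ℕ)) : ZMod ((F.P K).sitesPerDir 0))) + 2 * F.L ^ (i + 1) + m i ≤ 8 * F.L ^ (j + 1)),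 ‖BlockAveragingEMLLinearisedBackground.pertVar (Averaging.iter (fun i' => BlockAveraging.blockAvg (P := F.P K) (j := i') T3UnitLawDensityEML.ℰp) i U) (GaugeField.gaugeAct h (Averaging.iter (fun i' => BlockAveraging.blockAvg (P := F.P K) (j := i') T3UnitLawDensityEML.ℰp) i U')) b‖ ^ 2 ≤ 4 * ((F.L : ℝ) ^ i)⁻¹ * (∑ b : PBond (F.P K) 0, if (∀ k, (b.src k - ((((a.src k).val * F.L ^ (j + 1) : ℕ)) : ZMod ((F.P K).sitesPerDir 0)) + ((8 * F.L ^ (j + 1) : ℕ) : ZMod ((F.P K).sitesPerDir 0))).val < 17 * F.L ^ (j + 1)) ∧ (∀ k, (b.tgt k - ((((a.src k).val * F.L ^ (j + 1) : ℕ)) : ZMod ((F.P K).sitesPerDir 0)) + ((8 * F.L ^ (j + 1) : ℕ) : ZMod ((F.P K).sitesPerDir 0))).val < 17 * F.L ^ (j + 1)) then GaugeGroup.dist1 (U b * (U' b)⁻¹) ^ 2 else 0) → (1 / (10 ^ 8 * (L : ℝ) ^ 7)) ^ 2 * (4 / 9) ^ i < 4 * ((F.L : ℝ) ^ i)⁻¹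 * (∑ b : PBond (F.P K) 0, if (∀ k, (b.src k - ((((a.src k).val * F.L ^ (j + 1) : ℕ)) : ZMod ((F.P K).sitesPerDir 0)) + ((8 * F.L ^ (j + 1) : ℕ) : ZMod ((F.P K).sitesPerDir 0))).val < 17 * F.L ^ (j + 1)) ∧ (∀ k, (b.tgt k - ((((a.src k).val * F.L ^ (j + 1) : ℕ)) : ZMod ((F.P K).sitesPerDir 0)) + ((8 * F.L ^ (j + 1) : ℕ) : ZMod ((F.P K).sitesPerDir 0))).val < 17 * F.L ^ (j + 1)) then GaugeGroup.dist1 (U b * (U' b)⁻¹) ^ 2 else 0) → ∀ c ∈ Finset.univ.filter (fun b : PBond (F.P K) (i + 1) => Site.tdist (fun k => ((((b.src k).val * F.L ^ (i + 1) : ℕ)) : ZMod ((F.P K).sitesPerDir 0))) (fun k => ((((a.src k).val * F.L ^ (j + 1) : ℕ)) : ZMod ((F.P K).sitesPerDir 0))) + 2 * F.L ^ (i + 1 + 1) + m (i + 1) ≤ 8 * F.L ^ (j + 1)), ∀ b ∈ Finset.univ.filter (fun b : PBond (F.P K) i => blockOf b.src = c.src ∨ blockOf b.src = c.tgt), ‖BlockAveragingEMLLinearisedBackground.pertVar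 (Averaging.iter (fun i' => BlockAveraging.blockAvg (P := F.P K) (j := i') T3UnitLawDensityEML.ℰp) i U) (GaugeField.gaugeAct h (Averaging.iter (fun i' => BlockAveraging.blockAvg (P := F.P K) (j := i') T3UnitLawDensityEML.ℰp) i U')) b‖ ≤ σ i) :
    open Literature.MathematicalPhysics.QuantumFieldTheory.Balaban1983to89 Literature.MathematicalPhysics.QuantumFieldTheory.Balaban1983to89.T3ContinuumYM3Torus in ∀ (L : ℕ), ∃ CL : ℝ, 0 ≤ CL ∧ ∀ (b₀ p₀ : ℝ), 0 < b₀ → 2 < p₀ → ∃ γ₁ : ℝ, 0 < γ₁ ∧ γ₁ ≤ 1 ∧ ∀ (F : T3Family) (γ : ℝ), F.L = L → 0 < γ → γ ≤ γ₁ → ∀ (K j : ℕ), 1 ≤ j → j + 2 ≤ K → 2 ≤ j → ∀ (a : Plaq (F.P K) j) (U U' : GaugeField (F.P K) 0 (Matrix.specialUnitaryGroup (Fin 2) ℂ)), (∀ (i : ℕ) (q : Plaq (F.P K) i), i < j → Site.tdist (fun k => ((((q.src k).val * F.L ^ i : ℕ)) : ZMod ((F.P K).sitesPerDir 0))) (fun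 k => ((((a.src k).val * F.L ^ j : ℕ)) : ZMod ((F.P K).sitesPerDir 0))) + 64 * F.L ^ i ≤ 64 * F.L ^ j → GaugeGroup.dist1 (GaugeField.plaqHol (Averaging.iter (fun i' => BlockAveraging.blockAvg (P := F.P K) (j := i') T3UnitLawDensityEML.ℰp) i U) q) < T3UnitScaleTilt.θBal F.L γ b₀ p₀ (K - i)) → (∀ (i : ℕ) (q : Plaq (F.P K) i), i < j → Site.tdist (fun k => ((((q.src k).val * F.L ^ i : ℕ)) : ZMod ((F.P K).sitesPerDir 0))) (fun k => ((((a.src k).val * F.L ^ j : ℕ)) : ZMod ((F.P K).sitesPerDir 0))) + 64 * F.L ^ i ≤ 64 * F.L ^ j → GaugeGroup.dist1 (GaugeField.plaqHol (Averaging.iter (fun i' => BlockAveraging.blockAvg (P := F.P K) (j := i') T3UnitLawDensityEML.ℰp) i U') q) < T3UnitScaleTilt.θBal F.L γ b₀ p₀ (K - i)) → |GaugeGroup.dist1 (GaugeField.plaqHol (Averaging.iter (fun i' => BlockAveraging.blockAvg (P := F.P K) (j := i') T3UnitLawDensityEML.ℰp) j U) a) - GaugeGroup.dist1 (GaugeField.plaqHol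 (Averaging.iter (fun i' => BlockAveraging.blockAvg (P := F.P K) (j := i') T3UnitLawDensityEML.ℰp) j U') a)| ≤ CL / Real.sqrt ((F.L : ℝ) ^ j) * Real.sqrt (∑ b : PBond (F.P K) 0, if (∀ k, (b.src k - ((((a.src k).val * F.L ^ j : ℕ)) : ZMod ((F.P K).sitesPerDir 0)) + ((8 * F.L ^ j : ℕ) : ZMod ((F.P K).sitesPerDir 0))).val < 17 * F.L ^ j) ∧ (∀ k, (b.tgt k - ((((a.src k).val * F.L ^ j : ℕ)) : ZMod ((F.P K).sitesPerDir 0)) + ((8 * F.L ^ j : ℕ) : ZMod ((F.P K).sitesPerDir 0))).val < 17 * F.L ^ j) then GaugeGroup.dist1 (U b * (U' b)⁻¹) ^ 2 else 0) :=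
  stub_iteratedLipschitz_of_lowCharts (lowCharts_of_deepLowCharts hDeep)

end Summit.QuantumFields.YangMills.Theorems.PoincareLipschitzMassRowsOfDeepLowCharts

end
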